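import Summits.ResolutionOfSingularities.ResolutionOfSingularities.Theorems.FrobeniusLadderFInjectiveMacaulayficationBrieskornPhamMultiChart
import Summits.ResolutionOfSingularities.ResolutionOfSingularities.Theorems.FrobeniusLadderFInjectiveMacaulayficationF108ClassRowAnyField
import Summits.ResolutionOfSingularities.ResolutionOfSingularities.Theorems.FrobeniusLadderFInjectiveMacaulayficationPrimeDescentFieldExtension
import Summits.ResolutionOfSingularities.ResolutionOfSingularities.Theorems.FrobeniusLadderFInjectiveMacaulayficationGermOfGlobalBlowup
import Mathlib.FieldTheory.IsAlgClosed.AlgebraicClosure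
import HarnessLib

/-!
# GAP-2 «k ≠ k̄»: THE BRIESKORN–PHAM AND DIAGONAL FAMILY ROWS OVER ANY FIELD OF CHARACTERISTIC `p` — UNCONDITIONALLY, WITHOUT the primality witness `ω ∈ k`
# (crux `FInjectiveMacaulayfication` stmt-ResolutionOfSingularities-15315, chain w45a; seat res-L1-w45a-stub-2 g12, res-L1-w45a-plan-1 GO 2026-08-29T02:44:48Z; any-field twins of
# res-L1-w45a-stub-1's ✓ `BrieskornPhamRowOfF108.{brieskornPhamRow_of_F108Consumable, diagonalRow_of_F108Consumable'}` / ✓ p689071 `F108Unconditional.{brieskornPhamRow, diagonalRow_allP}`)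

[OURS · L1 W4.5a] Support file (`--supports stmt-ResolutionOfSingularities-15315 --as helper`); def-free; UNCONDITIONAL; no named fact, no sorry; NOT a statement of any manuscript;
replaces the role of NO printed item. Nothing of the crux is proved. AI-written (AI review weaker than expert review).

THE POINT. The family rows of record quantify over `k = k̄` for two reasons: the class theorem `F108ClassRow.pointFloorRow_of_F108Consumable` did, and the Specimen's primality proof
`BrieskornPhamSpecimen.prime_f … ω hω` needs a root `ω` of `ω^{a₁} = −1`. Both are now removable: ✓ `…F108ClassRowAnyField` gives the class row over any field from GEOMETRIC weak
non-degeneracy (which `BrieskornPhamSpecimen.weaklyNondegenerate_f`, field-general, supplies over `AlgebraicClosure k`), and ✓ `…PrimeDescentFieldExtension.prime_of_prime_map`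
DESCENDS primality from `K̄[X]` (where `ω` exists) to `k[X]`.
* §1 `natCast_ne_zero_algebraicClosure`, `map_f`, ★ `prime_f_anyField` (`z^c + x^{a₀} + y^{a₁} + u^{a₂} + t^{a₃}` is prime over EVERY field with `a₀ ≠ 0` in `k`, `2 ≤ c < a₂, a₃`,
  `0 < a₁`), `mk_X_ne_zero_anyField`, `vertex_not_mem_regularLocus_anyField`, `geom_weaklyNondegenerate_f`;
* §2 ★★ `brieskornPhamRow_anyField` — the Brieskorn–Pham two-floor class row ⟨LEGAL, NOT FULL, CURED⟩ for EVERY field `k` of characteristic `p` (`c ≥ 2`, `c < a₀ ≤ a₁, a₂, a₃`,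
  `a_j ≠ 0` in `k`, `⌊(p−1)/c⌋ + ⌊(p−1)/(a₀−c)⌋ < p−1`), UNCONDITIONAL;
* §3 ★ `diagonalRow_allP_anyField` — the diagonal double points `z² + x^a + y^a + u^a + t^a` (`a ≥ 5`, `a ≠ 0` in `k`), every `p`, every field;
* §4 ★ `brieskornPhamRow_fiveFloor_anyField` — the FIVE-FLOOR form (no ordering of the exponents; `Σ ⌊(p−1)/·⌋ < p−1`), any field (twin of ✓ `F108Unconditional.brieskornPhamRow_fiveFloor`);
* §5 ★★ `fInjectivizationGermAt_convenientWND_anyField` — the GERM FORM `FInjectivizationGermAt p v` at class level, any field (twin of ✓ `F108Unconditional.fInjectivizationGermAt_convenientWND`).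
SCOPE (desk caveat, binding): the vertex is the `k`-rational origin; within the class (isolated singularity AT the origin) nothing is lost relative to `k = k̄`.
[cite: IshiiSingularities2018, Thm. 4.4.23] [cite: Fedder1983, Thm. 1.12] [cite: Hartshorne1977, I Thm. 5.1] [cite: Matsumura1987, Thm. 7.5]
-/

-- single-problem summit: the doubled namespace component is forced
set_option linter.dupNamespace false

noncomputable section

namespace Summit.ResolutionOfSingularities.ResolutionOfSingularities.Theorems.FInjectiveMacaulayfication.BrieskornPhamAnyField

open CategoryTheory CategoryTheory.Limits AlgebraicGeometry TopologicalSpace IsLocalRing MvPolynomial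
open Literature.AlgebraicGeometry.Resolution Literature.AlgebraicGeometry.Resolution.BoubakriGreuelMarkwig
open Summit.ResolutionOfSingularities.ResolutionOfSingularities.Theorems.FInjectiveMacaulayfication
open SliceableCentre BrieskornPhamRowOfF108

variable (k : Type) [Field k]

/-! ## §1 The Specimen facts over any field (primality by descent from the algebraic closure) -/

/-- `a ≠ 0` in `k` ⇒ `a ≠ 0` in `AlgebraicClosure k`. [plumbing] -/
theorem natCast_ne_zero_algebraicClosure (a : ℕ) (ha : ((a : ℕ) : k) ≠ 0) : ((a : ℕ) : AlgebraicClosure k) ≠ 0 := fun h =>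
  ha ((algebraMap k (AlgebraicClosure k)).injective (by rw [map_natCast, map_zero]; exact h))

/-- The Brieskorn–Pham polynomial keeps its shape under extension of scalars. [plumbing] -/
theorem map_f (K : Type) [CommRing K] [Algebra k K] (c a₀ a₁ a₂ a₃ : ℕ) (f : MvPolynomial (Fin 5) k) (hf : f = X 4 ^ c + X 0 ^ a₀ + X 1 ^ a₁ + X 2 ^ a₂ + X 3 ^ a₃) :
    map (algebraMap k K) f = X 4 ^ c + X 0 ^ a₀ + X 1 ^ a₁ + X 2 ^ a₂ + X 3 ^ a₃ := by
  subst hf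
  simp

/-- ★ **`f = z^c + x^{a₀} + y^{a₁} + u^{a₂} + t^{a₃}` IS PRIME OVER EVERY FIELD** (`2 ≤ c < a₂, a₃`, `0 < a₁`, `a₀ ≠ 0` in `k`): prime over `AlgebraicClosure k` by
✓ `BrieskornPhamSpecimen.prime_f` with the witness `ω^{a₁} = −1` (`IsAlgClosed.exists_pow_nat_eq`), then ✓ `PrimeDescentFieldExtension.prime_of_prime_map`.
[OURS; cite: Matsumura1987, Thm. 7.5] -/
theorem prime_f_anyField (c a₀ a₁ a₂ a₃ : ℕ) (hc : 2 ≤ c) (h₁ : 0 < a₁) (h₂ : c < a₂) (h₃ : c < a₃) (ha₀ : ((a₀ : ℕ) : k) ≠ 0)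
    (f : MvPolynomial (Fin 5) k) (hf : f = X 4 ^ c + X 0 ^ a₀ + X 1 ^ a₁ + X 2 ^ a₂ + X 3 ^ a₃) : Prime f := by
  obtain ⟨ω, hω'⟩ := IsAlgClosed.exists_pow_nat_eq (-1 : AlgebraicClosure k) (n := a₁) h₁
  have hω : ω ^ a₁ + 1 = 0 := by rw [hω']; ring
  exact PrimeDescentFieldExtension.prime_of_prime_map f
    (BrieskornPhamSpecimen.prime_f (AlgebraicClosure k) c a₀ a₁ a₂ a₃ hc h₂ h₃ (natCast_ne_zero_algebraicClosure k a₀ ha₀) ω hω _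
      (map_f k (AlgebraicClosure k) c a₀ a₁ a₂ a₃ f hf))

/-- `x̄ⱼ ≠ 0` in `k[X]/(f)` over every field (primality + `f ∉ (Xⱼ)`). [plumbing] -/
theorem mk_X_ne_zero_anyField (c a₀ a₁ a₂ a₃ : ℕ) (hc : 2 ≤ c) (h₀ : c < a₀) (h₁ : c < a₁) (h₂ : c < a₂) (h₃ : c < a₃) (ha₀ : ((a₀ : ℕ) : k) ≠ 0)
    (f : MvPolynomial (Fin 5) k) (hf : f = X 4 ^ c + X 0 ^ a₀ + X 1 ^ a₁ + X 2 ^ a₂ + X 3 ^ a₃) (j : Fin 5) :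
    Ideal.Quotient.mk (Ideal.span {f}) (X j) ≠ 0 := fun h0 =>
  have hp := prime_f_anyField k c a₀ a₁ a₂ a₃ hc (by omega) h₂ h₃ ha₀ f hf
  PrimeTransfer.X_not_mem_span_of_isPrime ((Ideal.span_singleton_prime hp.ne_zero).mpr hp)
    (BrieskornPhamSpecimen.f_not_mem_span_X k c a₀ a₁ a₂ a₃ hc h₀ h₁ h₂ h₃ f hf j) (Ideal.Quotient.eq_zero_iff_mem.mp h0)

/-- The vertex is NOT regular, over every field: `f(0) = 0`, `∇f(0) = 0` (`c ≥ 2`, `a_j ≥ 2`); ✓ `BrieskornPhamSpecimen.vertex_not_mem_regularLocus` verbatim with the primality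
input replaced by `prime_f_anyField`. [cite: Hartshorne1977, I Thm. 5.1] -/
theorem vertex_not_mem_regularLocus_anyField (c a₀ a₁ a₂ a₃ : ℕ) (hc : 2 ≤ c) (h₀ : c < a₀) (h₁ : c < a₁) (h₂ : c < a₂) (h₃ : c < a₃) (ha₀ : ((a₀ : ℕ) : k) ≠ 0)
    (f : MvPolynomial (Fin 5) k) (hf : f = X 4 ^ c + X 0 ^ a₀ + X 1 ^ a₁ + X 2 ^ a₂ + X 3 ^ a₃)
    (v : Spec (.of (MvPolynomial (Fin 5) k ⧸ Ideal.span {f})))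
    (hv : v.asIdeal = Ideal.span (Set.range fun j : Fin 5 => Ideal.Quotient.mk (Ideal.span {f}) (X j))) :
    v ∉ Scheme.regularLocus (Spec (.of (MvPolynomial (Fin 5) k ⧸ Ideal.span {f}))) := by
  classical
  obtain ⟨e0, e1, e2, e3⟩ := BrieskornPhamSpecimen.pderiv_pow_f k c a₀ a₁ a₂ a₃ f hf
  refine GermOfGlobalBlowup.not_mem_regularLocus_Spec_of_not_isRegularLocalRing v ?_
  refine not_isRegularLocalRing_localization_of_pderiv_eval_eq_zero (0 : Fin 5 → k)
    (prime_f_anyField k c a₀ a₁ a₂ a₃ hc (by omega) h₂ h₃ ha₀ f hf).ne_zero ?_ ?_ v.asIdeal ?_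
  · rw [MvPolynomial.eval_zero]
    exact BrieskornPhamSpecimen.constantCoeff_f k c a₀ a₁ a₂ a₃ hc h₀ h₁ h₂ h₃ f hf
  · intro i
    by_cases hi4 : i = 4
    · subst hi4
      rw [BrieskornPhamSpecimen.pderiv_four_f k c a₀ a₁ a₂ a₃ f hf, map_mul, map_pow, MvPolynomial.eval_X, Pi.zero_apply,
        zero_pow (by omega : c - 1 ≠ 0), mul_zero]
    · rcases X2Cubic4Specimen.eq_cube_index_of_ne_four i hi4 with rfl | rfl | rfl | rfl
      · rw [e0, map_mul, map_pow, MvPolynomial.eval_X, Pi.zero_apply, zero_pow (by omega : a₀ - 1 ≠ 0), mul_zero]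
      · rw [e1, map_mul, map_pow, MvPolynomial.eval_X, Pi.zero_apply, zero_pow (by omega : a₁ - 1 ≠ 0), mul_zero]
      · rw [e2, map_mul, map_pow, MvPolynomial.eval_X, Pi.zero_apply, zero_pow (by omega : a₂ - 1 ≠ 0), mul_zero]
      · rw [e3, map_mul, map_pow, MvPolynomial.eval_X, Pi.zero_apply, zero_pow (by omega : a₃ - 1 ≠ 0), mul_zero]
  · rw [hv, DoublePointFermatCubicGerm.comap_origin k f (BrieskornPhamSpecimen.constantCoeff_f k c a₀ a₁ a₂ a₃ hc h₀ h₁ h₂ h₃ f hf), MvPolynomial.eval_zero,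
      Fedder.span_range_X_eq_ker]

/-- GEOMETRIC weak non-degeneracy of the Brieskorn–Pham polynomial: ✓ `BrieskornPhamSpecimen.weaklyNondegenerate_f` (field-general) over `AlgebraicClosure k`. [plumbing] -/
theorem geom_weaklyNondegenerate_f (c a₀ a₁ a₂ a₃ : ℕ)
    (ha₀ : ((a₀ : ℕ) : k) ≠ 0) (ha₁ : ((a₁ : ℕ) : k) ≠ 0) (ha₂ : ((a₂ : ℕ) : k) ≠ 0) (ha₃ : ((a₃ : ℕ) : k) ≠ 0)
    (f : MvPolynomial (Fin 5) k) (hf : f = X 4 ^ c + X 0 ^ a₀ + X 1 ^ a₁ + X 2 ^ a₂ + X 3 ^ a₃) :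
    ∀ w : Fin 5 → ℝ, (∀ i, 0 < w i) →
      IsWeaklyNondegenerateAlong w ((map (algebraMap k (AlgebraicClosure k)) f : MvPolynomial (Fin 5) (AlgebraicClosure k)) :
        MvPowerSeries (Fin 5) (AlgebraicClosure k)) :=
  BrieskornPhamSpecimen.weaklyNondegenerate_f (AlgebraicClosure k) c a₀ a₁ a₂ a₃ (natCast_ne_zero_algebraicClosure k a₀ ha₀)
    (natCast_ne_zero_algebraicClosure k a₁ ha₁) (natCast_ne_zero_algebraicClosure k a₂ ha₂) (natCast_ne_zero_algebraicClosure k a₃ ha₃) _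
    (map_f k (AlgebraicClosure k) c a₀ a₁ a₂ a₃ f hf)

/-! ## §2 ★★ The Brieskorn–Pham class row over any field, unconditionally -/

/-- ★★ **THE BRIESKORN–PHAM CLASS ROW OVER ANY FIELD OF CHARACTERISTIC `p`, UNCONDITIONAL**: for EVERY field `k` of characteristic `p`, every multiplicity `c ≥ 2` (no hypothesis on
`c` mod `p`), exponents `c < a₀ ≤ a₁, a₂, a₃` with `a_j ≠ 0` in `k`, the floor inequality `⌊(p−1)/c⌋ + ⌊(p−1)/(a₀−c)⌋ < p−1`, and EVERY blowing up `g : S′ → Spec 𝒪_{X,v}` of the germ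
of `X = V(z^c + x^{a₀} + y^{a₁} + u^{a₂} + t^{a₃})` at the origin along the point floor: (LEGAL) ∧ (NOT FULL) ∧ (CURED). ONE term on ✓ `F108ClassRowAnyField.pointFloorRow_of_convenient_anyField`
with `K := AlgebraicClosure k`; primality by descent (§1), no `ω ∈ k` needed. Any-field twin of ✓ `F108Unconditional.brieskornPhamRow` / `BrieskornPhamRowOfF108.brieskornPhamRow_of_F108Consumable`.
[OURS · class row, unconditional; cite: IshiiSingularities2018, Thm. 4.4.23; Fedder1983, Thm. 1.12] -/
theorem brieskornPhamRow_anyField (p : ℕ) [Fact p.Prime] [CharP k p]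
    (c a₀ a₁ a₂ a₃ : ℕ) (hc : 2 ≤ c) (h₀ : c < a₀) (h₀₁ : a₀ ≤ a₁) (h₀₂ : a₀ ≤ a₂) (h₀₃ : a₀ ≤ a₃)
    (ha₀ : ((a₀ : ℕ) : k) ≠ 0) (ha₁ : ((a₁ : ℕ) : k) ≠ 0) (ha₂ : ((a₂ : ℕ) : k) ≠ 0) (ha₃ : ((a₃ : ℕ) : k) ≠ 0) (hab : (p - 1) / c + (p - 1) / (a₀ - c) < p - 1)
    (f : MvPolynomial (Fin 5) k) (hf : f = X 4 ^ c + X 0 ^ a₀ + X 1 ^ a₁ + X 2 ^ a₂ + X 3 ^ a₃)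
    (v : Spec (.of (MvPolynomial (Fin 5) k ⧸ Ideal.span {f})))
    (hv : v.asIdeal = Ideal.span (Set.range (fun j : Fin 5 => Ideal.Quotient.mk (Ideal.span {f}) (X j))))
    (S' : Scheme.{0}) (g : S' ⟶ Spec ((Spec (.of (MvPolynomial (Fin 5) k ⧸ Ideal.span {f}))).presheaf.stalk v))
    (hg : IsBlowup g ((affineBlowup.idealSheaf (Ideal.span (Set.range (fun j : Fin 5 => Ideal.Quotient.mk (Ideal.span {f}) (X j))))).comap ((Spec (.of (MvPolynomial (Fin 5) k ⧸ Ideal.span {f}))).fromSpecStalk v))) :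
    (((affineBlowup.idealSheaf (Ideal.span (Set.range fun j : Fin 5 => Ideal.Quotient.mk (Ideal.span {f}) (X j)))).comap
        ((Spec (.of (MvPolynomial (Fin 5) k ⧸ Ideal.span {f}))).fromSpecStalk v)) ≠ ⊥ ∧
      ((((affineBlowup.idealSheaf (Ideal.span (Set.range fun j : Fin 5 => Ideal.Quotient.mk (Ideal.span {f}) (X j)))).comap
        ((Spec (.of (MvPolynomial (Fin 5) k ⧸ Ideal.span {f}))).fromSpecStalk v)).support :
          Set (Spec ((Spec (.of (MvPolynomial (Fin 5) k ⧸ Ideal.span {f}))).presheaf.stalk v))) ⊆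
        (Scheme.regularLocus (Spec ((Spec (.of (MvPolynomial (Fin 5) k ⧸ Ideal.span {f}))).presheaf.stalk v)))ᶜ) ∧
      (∀ s : S', g.base s ≠ closedPoint _ → s ∈ Scheme.regularLocus S') ∧ (∀ s : S', CMCl (S'.presheaf.stalk s))) ∧
    (∃ s : S', g.base s = closedPoint _ ∧ ¬ FullCl p (S'.presheaf.stalk s)) ∧
    (∃ 𝓚 : S'.IdealSheafData, 𝓚 ≠ ⊥ ∧ (∀ s ∈ (𝓚.support : Set S'), g.base s = closedPoint _) ∧
      ∀ (S'' : Scheme.{0}) (π : S'' ⟶ S'), IsBlowup π 𝓚 → ∀ s : S'', FullCl p (S''.presheaf.stalk s)) := by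
  have hprime := prime_f_anyField k c a₀ a₁ a₂ a₃ hc (by omega) (by omega) (by omega) ha₀ f hf
  exact F108ClassRowAnyField.pointFloorRow_of_convenient_anyField k (AlgebraicClosure k) p (by norm_num) f hprime
    (BrieskornPhamSpecimen.convenient_f k c a₀ a₁ a₂ a₃ hc h₀ (by omega) (by omega) (by omega) f hf)
    (geom_weaklyNondegenerate_f k c a₀ a₁ a₂ a₃ ha₀ ha₁ ha₂ ha₃ f hf)
    (mk_X_ne_zero_anyField k c a₀ a₁ a₂ a₃ hc h₀ (by omega) (by omega) (by omega) ha₀ f hf)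
    (fun x hx => BrieskornPhamSpecimen.regular_off_vertex k c a₀ a₁ a₂ a₃ hc h₀ (by omega) (by omega) (by omega) ha₀ ha₁ ha₂ ha₃ f hf x.asIdeal hx)
    (fun _ : Fin 5 => c) _ (theta k c a₀ a₁ a₂ a₃ h₀ (by omega) (by omega) (by omega) f hf)
    (BrieskornPhamSpecimen.f_not_mem_span_X k c a₀ a₁ a₂ a₃ hc h₀ (by omega) (by omega) (by omega) f hf) (g_not_mem_span_X k c a₀ a₁ a₂ a₃ h₀ (by omega) (by omega) (by omega))
    (BrieskornPhamSpecimen.constantCoeff_f k c a₀ a₁ a₂ a₃ hc h₀ (by omega) (by omega) (by omega) f hf) 0 (constantCoeff_g_zero k c a₀ a₁ a₂ a₃ hc h₀ (by omega) (by omega) (by omega))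
    (by
      rw [Matrix.cons_val_zero, g_zero_eq_twoTerm k c a₀ a₁ a₂ a₃ h₀ h₀₁ h₀₂ h₀₃]
      exact TwoTermFedder.twoTerm_pow_mem_frobeniusPower k p 4 0 c (a₀ - c) (by omega) (by omega) hab _)
    v hv (vertex_not_mem_regularLocus_anyField k c a₀ a₁ a₂ a₃ hc h₀ (by omega) (by omega) (by omega) ha₀ f hf v hv) S' g hg

/-! ## §3 ★ The diagonal double points at every prime, any field -/

/-- ★ **THE DIAGONAL DOUBLE-POINT FAMILY `z² + x^a + y^a + u^a + t^a` (`a ≥ 5`, `a ≠ 0` in `k`) OVER ANY FIELD, EVERY `p` (`p = 2` included)**: the `c = 2` member of §2; the floor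
inequality `⌊(p−1)/2⌋ + ⌊(p−1)/(a−2)⌋ < p−1` holds for every `p` (✓ `TwoTermFedder.floor_half_add_floor_lt`). Any-field twin of ✓ `F108Unconditional.diagonalRow_allP`.
[OURS · class row, unconditional; cite: IshiiSingularities2018, Thm. 4.4.23; Fedder1983, Thm. 1.12] -/
theorem diagonalRow_allP_anyField (p : ℕ) [Fact p.Prime] [CharP k p] (a : ℕ) (ha5 : 5 ≤ a) (haK : ((a : ℕ) : k) ≠ 0) (f : MvPolynomial (Fin 5) k)
    (hf : f = X 4 ^ 2 + X 0 ^ a + X 1 ^ a + X 2 ^ a + X 3 ^ a)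
    (v : Spec (.of (MvPolynomial (Fin 5) k ⧸ Ideal.span {f})))
    (hv : v.asIdeal = Ideal.span (Set.range (fun j : Fin 5 => Ideal.Quotient.mk (Ideal.span {f}) (X j))))
    (S' : Scheme.{0}) (g : S' ⟶ Spec ((Spec (.of (MvPolynomial (Fin 5) k ⧸ Ideal.span {f}))).presheaf.stalk v))
    (hg : IsBlowup g ((affineBlowup.idealSheaf (Ideal.span (Set.range (fun j : Fin 5 => Ideal.Quotient.mk (Ideal.span {f}) (X j))))).comap ((Spec (.of (MvPolynomial (Fin 5) k ⧸ Ideal.span {f}))).fromSpecStalk v))) :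
    (((affineBlowup.idealSheaf (Ideal.span (Set.range fun j : Fin 5 => Ideal.Quotient.mk (Ideal.span {f}) (X j)))).comap
        ((Spec (.of (MvPolynomial (Fin 5) k ⧸ Ideal.span {f}))).fromSpecStalk v)) ≠ ⊥ ∧
      ((((affineBlowup.idealSheaf (Ideal.span (Set.range fun j : Fin 5 => Ideal.Quotient.mk (Ideal.span {f}) (X j)))).comap
        ((Spec (.of (MvPolynomial (Fin 5) k ⧸ Ideal.span {f}))).fromSpecStalk v)).support :
          Set (Spec ((Spec (.of (MvPolynomial (Fin 5) k ⧸ Ideal.span {f}))).presheaf.stalk v))) ⊆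
        (Scheme.regularLocus (Spec ((Spec (.of (MvPolynomial (Fin 5) k ⧸ Ideal.span {f}))).presheaf.stalk v)))ᶜ) ∧
      (∀ s : S', g.base s ≠ closedPoint _ → s ∈ Scheme.regularLocus S') ∧ (∀ s : S', CMCl (S'.presheaf.stalk s))) ∧
    (∃ s : S', g.base s = closedPoint _ ∧ ¬ FullCl p (S'.presheaf.stalk s)) ∧
    (∃ 𝓚 : S'.IdealSheafData, 𝓚 ≠ ⊥ ∧ (∀ s ∈ (𝓚.support : Set S'), g.base s = closedPoint _) ∧
      ∀ (S'' : Scheme.{0}) (π : S'' ⟶ S'), IsBlowup π 𝓚 → ∀ s : S'', FullCl p (S''.presheaf.stalk s)) :=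
  brieskornPhamRow_anyField k p 2 a a a a le_rfl (by omega) le_rfl le_rfl le_rfl haK haK haK haK
    (TwoTermFedder.floor_half_add_floor_lt p (a - 2) (Fact.out : p.Prime).two_le (by omega)) f hf v hv S' g hg

/-! ## §4 ★ The five-floor form, any field -/

/-- ★ **THE BRIESKORN–PHAM ROW, FIVE-FLOOR FORM, OVER ANY FIELD OF CHARACTERISTIC `p`, UNCONDITIONAL** (no ordering of the exponents; Fedder witness from the five floors
`⌊(p−1)/c⌋ + ⌊(p−1)/(a₀−c)⌋ + Σ_{j≥1} ⌊(p−1)/a_j⌋ < p−1`): any-field twin of ✓ `BrieskornPhamMultiChart.brieskornPhamRow_of_F108Consumable_of_fiveFloor` /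
✓ `F108Unconditional.brieskornPhamRow_fiveFloor` — ONE term on ✓ `F108ClassRowAnyField.pointFloorRow_of_convenient_anyField`, primality by descent (§1).
[OURS · class row, unconditional; cite: IshiiSingularities2018, Thm. 4.4.23; Fedder1983, Thm. 1.12] -/
theorem brieskornPhamRow_fiveFloor_anyField (p : ℕ) [Fact p.Prime] [CharP k p]
    (c a₀ a₁ a₂ a₃ : ℕ) (hc : 2 ≤ c) (h₀ : c < a₀) (h₁ : c < a₁) (h₂ : c < a₂) (h₃ : c < a₃)
    (ha₀ : ((a₀ : ℕ) : k) ≠ 0) (ha₁ : ((a₁ : ℕ) : k) ≠ 0) (ha₂ : ((a₂ : ℕ) : k) ≠ 0) (ha₃ : ((a₃ : ℕ) : k) ≠ 0)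
    (hΦ : (p - 1) / c + (p - 1) / (a₀ - c) + (p - 1) / a₁ + (p - 1) / a₂ + (p - 1) / a₃ < p - 1)
    (f : MvPolynomial (Fin 5) k) (hf : f = X 4 ^ c + X 0 ^ a₀ + X 1 ^ a₁ + X 2 ^ a₂ + X 3 ^ a₃)
    (v : Spec (.of (MvPolynomial (Fin 5) k ⧸ Ideal.span {f})))
    (hv : v.asIdeal = Ideal.span (Set.range (fun j : Fin 5 => Ideal.Quotient.mk (Ideal.span {f}) (X j))))
    (S' : Scheme.{0}) (g : S' ⟶ Spec ((Spec (.of (MvPolynomial (Fin 5) k ⧸ Ideal.span {f}))).presheaf.stalk v))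
    (hg : IsBlowup g ((affineBlowup.idealSheaf (Ideal.span (Set.range (fun j : Fin 5 => Ideal.Quotient.mk (Ideal.span {f}) (X j))))).comap ((Spec (.of (MvPolynomial (Fin 5) k ⧸ Ideal.span {f}))).fromSpecStalk v))) :
    (((affineBlowup.idealSheaf (Ideal.span (Set.range fun j : Fin 5 => Ideal.Quotient.mk (Ideal.span {f}) (X j)))).comap
        ((Spec (.of (MvPolynomial (Fin 5) k ⧸ Ideal.span {f}))).fromSpecStalk v)) ≠ ⊥ ∧
      ((((affineBlowup.idealSheaf (Ideal.span (Set.range fun j : Fin 5 => Ideal.Quotient.mk (Ideal.span {f}) (X j)))).comap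
        ((Spec (.of (MvPolynomial (Fin 5) k ⧸ Ideal.span {f}))).fromSpecStalk v)).support :
          Set (Spec ((Spec (.of (MvPolynomial (Fin 5) k ⧸ Ideal.span {f}))).presheaf.stalk v))) ⊆
        (Scheme.regularLocus (Spec ((Spec (.of (MvPolynomial (Fin 5) k ⧸ Ideal.span {f}))).presheaf.stalk v)))ᶜ) ∧
      (∀ s : S', g.base s ≠ closedPoint _ → s ∈ Scheme.regularLocus S') ∧ (∀ s : S', CMCl (S'.presheaf.stalk s))) ∧
    (∃ s : S', g.base s = closedPoint _ ∧ ¬ FullCl p (S'.presheaf.stalk s)) ∧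
    (∃ 𝓚 : S'.IdealSheafData, 𝓚 ≠ ⊥ ∧ (∀ s ∈ (𝓚.support : Set S'), g.base s = closedPoint _) ∧
      ∀ (S'' : Scheme.{0}) (π : S'' ⟶ S'), IsBlowup π 𝓚 → ∀ s : S'', FullCl p (S''.presheaf.stalk s)) := by
  have hprime := prime_f_anyField k c a₀ a₁ a₂ a₃ hc (by omega) h₂ h₃ ha₀ f hf
  exact F108ClassRowAnyField.pointFloorRow_of_convenient_anyField k (AlgebraicClosure k) p (by norm_num) f hprime
    (BrieskornPhamSpecimen.convenient_f k c a₀ a₁ a₂ a₃ hc h₀ h₁ h₂ h₃ f hf)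
    (geom_weaklyNondegenerate_f k c a₀ a₁ a₂ a₃ ha₀ ha₁ ha₂ ha₃ f hf)
    (mk_X_ne_zero_anyField k c a₀ a₁ a₂ a₃ hc h₀ h₁ h₂ h₃ ha₀ f hf)
    (fun x hx => BrieskornPhamSpecimen.regular_off_vertex k c a₀ a₁ a₂ a₃ hc h₀ h₁ h₂ h₃ ha₀ ha₁ ha₂ ha₃ f hf x.asIdeal hx)
    (fun _ : Fin 5 => c) _ (BrieskornPhamRowOfF108.theta k c a₀ a₁ a₂ a₃ h₀ h₁ h₂ h₃ f hf)
    (BrieskornPhamSpecimen.f_not_mem_span_X k c a₀ a₁ a₂ a₃ hc h₀ h₁ h₂ h₃ f hf) (BrieskornPhamRowOfF108.g_not_mem_span_X k c a₀ a₁ a₂ a₃ h₀ h₁ h₂ h₃)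
    (BrieskornPhamSpecimen.constantCoeff_f k c a₀ a₁ a₂ a₃ hc h₀ h₁ h₂ h₃ f hf) 0 (BrieskornPhamRowOfF108.constantCoeff_g_zero k c a₀ a₁ a₂ a₃ hc h₀ h₁ h₂ h₃)
    (by
      rw [Matrix.cons_val_zero, BrieskornPhamMultiChart.g_zero_eq_listSum k c a₀ a₁ a₂ a₃]
      refine BrieskornPhamMultiChart.listSum_pow_mem_frobeniusPower k p _ ?_ (p - 1) ?_
      · simp only [List.mem_cons, List.not_mem_nil, or_false]; rintro t (rfl | rfl | rfl | rfl | rfl) <;> simp only <;> omega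
      · simp only [List.map_cons, List.map_nil, List.sum_cons, List.sum_nil]; omega)
    v hv (vertex_not_mem_regularLocus_anyField k c a₀ a₁ a₂ a₃ hc h₀ h₁ h₂ h₃ ha₀ f hf v hv) S' g hg

/-! ## §5 ★★ The germ form at class level, any field -/

/-- ★★ **THE GERM FORM AT CLASS LEVEL OVER ANY FIELD OF CHARACTERISTIC `p`, UNCONDITIONAL**: `FInjectivizationGermAt p v` at the `k`-rational vertex of every prime, convenient,
GEOMETRICALLY weakly non-degenerate isolated hypersurface point (`K ⊇ k` algebraically closed) — the F-half's ∃-conclusion at the trivial input, witnessed by the `𝔪`-primary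
monomial centre `(x^A)` of ✓ `F108ClassRowAnyField.affineBlowup_fullCl_of_convenient_anyField`. Any-field twin of ✓ p689071 `F108Unconditional.fInjectivizationGermAt_convenientWND`.
[OURS · unconditional class theorem; cite: GortzWedhorn2020, Prop. 13.91 (2)] -/
theorem fInjectivizationGermAt_convenientWND_anyField (K : Type) [Field K] [Algebra k K] [IsAlgClosed K] (p : ℕ) [Fact p.Prime] [CharP k p] {n : ℕ} (hn : 0 < n)
    (f : MvPolynomial (Fin n) k) (hfp : Prime f) (hconv : ∀ j : Fin n, ∃ N : ℕ, 0 < N ∧ MvPolynomial.coeff (Finsupp.single j N) f ≠ 0)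
    (hWND : ∀ w : Fin n → ℝ, (∀ i, 0 < w i) →
      IsWeaklyNondegenerateAlong w ((map (algebraMap k K) f : MvPolynomial (Fin n) K) : MvPowerSeries (Fin n) K))
    (hXne : ∀ v : Fin n, Ideal.Quotient.mk (Ideal.span {f}) (X v) ≠ 0)
    (hreg : ∀ x : Spec (.of (MvPolynomial (Fin n) k ⧸ Ideal.span {f})),
      ¬ Ideal.span (Set.range fun j : Fin n => Ideal.Quotient.mk (Ideal.span {f}) (X j)) ≤ x.asIdeal → IsRegularLocalRing (Localization.AtPrime x.asIdeal))
    (v : Spec (.of (MvPolynomial (Fin n) k ⧸ Ideal.span {f})))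
    (hvm : v.asIdeal = Ideal.span (Set.range fun j : Fin n => Ideal.Quotient.mk (Ideal.span {f}) (X j))) :
    GermForm.FInjectivizationGermAt p v := by
  haveI hfprime : (Ideal.span {f}).IsPrime := (Ideal.span_singleton_prime hfp.ne_zero).mpr hfp
  haveI : IsDomain (MvPolynomial (Fin n) k ⧸ Ideal.span {f}) := Ideal.Quotient.isDomain _
  obtain ⟨A, hprim, hfull⟩ := F108ClassRowAnyField.affineBlowup_fullCl_of_convenient_anyField k K p f hfp hconv hWND hXne hreg
  have hmono : ∀ e : Fin n →₀ ℕ, Ideal.Quotient.mk (Ideal.span {f}) (monomial e (1 : k)) ≠ 0 := fun e =>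
    CIConeFiModelCore.mk_monomial_ne_zero (Ideal.span {f}) hXne e
  have hI : Ideal.span ((fun e : Fin n →₀ ℕ => Ideal.Quotient.mk (Ideal.span {f}) (monomial e (1 : k))) '' (A : Set (Fin n →₀ ℕ))) ≠ ⊥ := by
    intro h0
    obtain ⟨N, hN⟩ := hprim ⟨0, hn⟩ (Finset.mem_univ _)
    exact hmono _ ((Submodule.eq_bot_iff _).mp h0 _ (Ideal.subset_span ⟨_, hN, rfl⟩))
  have hvA : v.asIdeal ≤ (Ideal.span ((fun e : Fin n →₀ ℕ => Ideal.Quotient.mk (Ideal.span {f}) (monomial e (1 : k))) '' (A : Set (Fin n →₀ ℕ)))).radical := by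
    rw [hvm, Ideal.span_le]
    rintro _ ⟨j, rfl⟩
    obtain ⟨N, hN⟩ := hprim j (Finset.mem_univ _)
    exact ⟨N, by rw [← map_pow, X_pow_eq_monomial]; exact Ideal.subset_span ⟨_, hN, rfl⟩⟩
  exact GermOfGlobalBlowup.fInjectivizationGermAt_of_affineBlowup p _ hI v hvA hfull

end Summit.ResolutionOfSingularities.ResolutionOfSingularities.Theorems.FInjectiveMacaulayfication.BrieskornPhamAnyField

end
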